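import Literature.NumberTheory.EllipticCurves.BinaryQuarticFormsProofs
import Mathlib.Algebra.BigOperators.Field
import HarnessLib

/-!
# `PGL₂(ℚ)`-classes of integral binary quartic forms counted through `GL₂(ℤ)`-orbits:
# `N = Σ_{GL₂(ℤ)-orbits O} 1/n(O)`

Topic `Literature/NumberTheory/EllipticCurves`; companion of `BinaryQuarticForms.lean`
(`BinaryQuartic.pgl2QClassCount`, `BinaryQuartic.gl2zOrbit`, `GL2ZEquiv`, `PGL2Equiv`) for
M. Bhargava, A. Shankar, *Binary quartic forms having bounded invariants, and the boundedness of the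
average rank of elliptic curves*, Ann. of Math. (2) 181 (2015) 191–242.

The `2`-Selmer elements of `E` are counted as `PGL₂(ℚ)`-classes of locally soluble integral
forms (Thm 5.6 of the held arXiv text `arXiv:1006.1002v2`; §3.1–3.2 of the published version),
whereas the geometry of numbers (Thm 2.1) counts `GL₂(ℤ)`-orbits. The passage between the two is
the elementary identity (published version §3.2, first paragraphs): every `PGL₂(ℚ)`-class of a
`GL₂(ℤ)`-invariant set `S ⊂ V_ℤ` is a union of `GL₂(ℤ)`-orbits (`GL2ZEquiv.pgl2Equiv_map`), so
that, writing `n(O)` for the number of `GL₂(ℤ)`-orbits of `S` lying in the `PGL₂(ℚ)`-class of the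
orbit `O`,

  `#{PGL₂(ℚ)-classes of S} = Σ_{GL₂(ℤ)-orbits O of S} 1/n(O)`.

This file proves it (`pgl2QClassCount_eq_sum_one_div`), for any set `S` of integral forms meeting
finitely many `GL₂(ℤ)`-orbits, from the generic double-counting identity
`#π(S) = Σ_{a ∈ S} 1/#(fibre of π through a)` (`Finset.card_image_eq_sum_one_div_card_fiber`).
No named facts.

## References

* [BhargavaShankarAnnals2015] §5.2 (`S^F`: "from each `PGL₂(ℚ)`-orbit, one `GL₂(ℤ)`-orbit";
  arXiv v2 numbering) = §3.2 of the published version (the weights `1/n(f)`).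
  [cite: BhargavaShankarAnnals2015, §5.2 (PGL₂(ℚ)-orbits vs GL₂(ℤ)-orbits; arXiv:1006.1002v2 numbering)]
-/

noncomputable section

open scoped Classical
open Finset

/-- **Double counting along the fibres of a map**: the number of values of `π` on a finite set `S`
is `Σ_{a ∈ S} 1/#{b ∈ S : π b = π a}` (a deliberate dot-notation extension of Mathlib's `Finset`
namespace, next to `Finset.card_eq_sum_card_image`). [folklore] -/
theorem Finset.card_image_eq_sum_one_div_card_fiber {α β : Type*} [DecidableEq α] [DecidableEq β]
    (S : Finset α) (π : α → β) :
    ((S.image π).card : ℚ) = ∑ a ∈ S, (1 : ℚ) / (S.filter (fun b ↦ π b = π a)).card := by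
  rw [← Finset.sum_fiberwise_of_maps_to (g := π) (t := S.image π)
    (fun a ha ↦ Finset.mem_image_of_mem π ha)]
  rw [Finset.card_eq_sum_ones, Nat.cast_sum]
  refine Finset.sum_congr rfl fun c hc ↦ ?_
  obtain ⟨a₀, ha₀, rfl⟩ := Finset.mem_image.mp hc
  have hfib : ∀ a ∈ S.filter (fun b ↦ π b = π a₀),
      (1 : ℚ) / (S.filter (fun b ↦ π b = π a)).card =
        (1 : ℚ) / (S.filter (fun b ↦ π b = π a₀)).card := by
    intro a ha
    rw [(Finset.mem_filter.mp ha).2]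
  rw [Finset.sum_congr rfl hfib, Finset.sum_const, nsmul_eq_mul]
  have hpos : ((S.filter (fun b ↦ π b = π a₀)).card : ℚ) ≠ 0 := by
    rw [Nat.cast_ne_zero]
    exact Finset.card_ne_zero.mpr ⟨a₀, Finset.mem_filter.mpr ⟨ha₀, rfl⟩⟩
  push_cast
  field_simp

namespace Literature.NumberTheory.EllipticCurves

namespace BinaryQuartic

/-- Two `GL₂(ℤ)`-orbits are `PGL₂(ℚ)`-related if some (equivalently, all) of their elements are
`PGL₂(ℚ)`-equivalent. [folklore] -/
def OrbitPGL2Equiv (O O' : Set (BinaryQuartic ℤ)) : Prop :=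
  ∃ f ∈ O, ∃ f' ∈ O', PGL2Equiv (f.map (Int.castRingHom ℚ)) (f'.map (Int.castRingHom ℚ))

/-- Elements of the same `GL₂(ℤ)`-orbit are `PGL₂(ℚ)`-equivalent. [folklore] -/
theorem pgl2Equiv_of_mem_gl2zOrbit {f g : BinaryQuartic ℤ} (h : g ∈ gl2zOrbit f) :
    PGL2Equiv (f.map (Int.castRingHom ℚ)) (g.map (Int.castRingHom ℚ)) :=
  GL2ZEquiv.pgl2Equiv_map h

/-- For orbits `O = GL₂(ℤ)f₀`, `O' = GL₂(ℤ)f₀'`: `O ~ O'` iff `f₀ ~_{PGL₂(ℚ)} f₀'`. [folklore] -/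
theorem orbitPGL2Equiv_gl2zOrbit_iff (f₀ f₀' : BinaryQuartic ℤ) :
    OrbitPGL2Equiv (gl2zOrbit f₀) (gl2zOrbit f₀') ↔
      PGL2Equiv (f₀.map (Int.castRingHom ℚ)) (f₀'.map (Int.castRingHom ℚ)) := by
  constructor
  · rintro ⟨f, hf, f', hf', h⟩
    exact ((pgl2Equiv_of_mem_gl2zOrbit hf).trans h).trans (pgl2Equiv_of_mem_gl2zOrbit hf').symm
  · intro h
    exact ⟨f₀, GL2ZEquiv.refl f₀, f₀', GL2ZEquiv.refl f₀', h⟩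

/-- **`#{PGL₂(ℚ)-classes of S} = Σ_{GL₂(ℤ)-orbits O meeting S} 1/n(O)`**, where `n(O)` is the
number of `GL₂(ℤ)`-orbits meeting `S` that are `PGL₂(ℚ)`-related to `O` (Bhargava–Shankar,
published version §3.2: each `PGL₂(ℚ)`-class is counted through its `GL₂(ℤ)`-orbits with weight
`1/n`). Here `S` is any set of integral forms meeting finitely many `GL₂(ℤ)`-orbits
(`hfin : (gl2zOrbit '' S).Finite`), `pgl2QClassCount S` counts the `PGL₂(ℚ)`-classes met by `S`,
and the sum runs over `T = {GL₂(ℤ)f : f ∈ S}`.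
[cite: BhargavaShankarAnnals2015, §5.2 (arXiv:1006.1002v2 numbering) = §3.2 of the published version] -/
theorem pgl2QClassCount_eq_sum_one_div (S : Set (BinaryQuartic ℤ)) (hfin : (gl2zOrbit '' S).Finite) :
    (pgl2QClassCount S : ℚ) =
      ∑ O ∈ hfin.toFinset, (1 : ℚ) / (hfin.toFinset.filter (fun O' ↦ OrbitPGL2Equiv O' O)).card := by
  -- the class map on forms and on orbits
  set π : BinaryQuartic ℤ → Set (BinaryQuartic ℤ) :=
    fun f ↦ {g | g ∈ S ∧ PGL2Equiv (f.map (Int.castRingHom ℚ)) (g.map (Int.castRingHom ℚ))} with hπ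
  set πbar : Set (BinaryQuartic ℤ) → Set (BinaryQuartic ℤ) :=
    fun O ↦ {g | g ∈ S ∧ ∃ f ∈ O, PGL2Equiv (f.map (Int.castRingHom ℚ)) (g.map (Int.castRingHom ℚ))}
    with hπbar
  -- `πbar (GL₂(ℤ)f₀) = π f₀`
  have hπbar_orbit : ∀ f₀ : BinaryQuartic ℤ, πbar (gl2zOrbit f₀) = π f₀ := by
    intro f₀
    ext g
    simp only [hπbar, hπ, Set.mem_setOf_eq]
    refine and_congr_right fun _ ↦ ⟨?_, ?_⟩
    · rintro ⟨f, hf, h⟩; exact (pgl2Equiv_of_mem_gl2zOrbit hf).trans h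
    · intro h; exact ⟨f₀, GL2ZEquiv.refl f₀, h⟩
  -- classes of equivalent forms coincide
  have hπ_eq : ∀ {f f' : BinaryQuartic ℤ},
      PGL2Equiv (f.map (Int.castRingHom ℚ)) (f'.map (Int.castRingHom ℚ)) → π f = π f' := by
    intro f f' h
    ext g
    simp only [hπ, Set.mem_setOf_eq]
    exact and_congr_right fun _ ↦ ⟨fun h' ↦ h.symm.trans h', fun h' ↦ h.trans h'⟩
  -- (1) the set of classes is the image of the orbit finset
  have himage : ((fun f ↦ {g | g ∈ S ∧
      PGL2Equiv (f.map (Int.castRingHom ℚ)) (g.map (Int.castRingHom ℚ))}) '' S) =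
      ((hfin.toFinset.image πbar : Finset (Set (BinaryQuartic ℤ))) : Set (Set (BinaryQuartic ℤ))) := by
    ext C
    simp only [Set.mem_image, Finset.coe_image, Set.Finite.coe_toFinset]
    constructor
    · rintro ⟨f₀, hf₀, rfl⟩
      exact ⟨gl2zOrbit f₀, ⟨f₀, hf₀, rfl⟩, hπbar_orbit f₀⟩
    · rintro ⟨O, ⟨f₀, hf₀, rfl⟩, rfl⟩
      exact ⟨f₀, hf₀, (hπbar_orbit f₀).symm⟩
  -- (2) fibres of `πbar` on orbits are the `~`-classes
  have hfiber : ∀ O ∈ hfin.toFinset, ∀ O' ∈ hfin.toFinset, (πbar O' = πbar O ↔ OrbitPGL2Equiv O' O) := by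
    intro O hO O' hO'
    rw [Set.Finite.mem_toFinset] at hO hO'
    obtain ⟨f₀, hf₀, rfl⟩ := hO
    obtain ⟨f₀', hf₀', rfl⟩ := hO'
    rw [hπbar_orbit, hπbar_orbit, orbitPGL2Equiv_gl2zOrbit_iff]
    constructor
    · intro h
      have : f₀ ∈ π f₀ := ⟨hf₀, PGL2Equiv.refl _⟩
      rw [← h] at this
      exact this.2
    · intro h
      exact hπ_eq h
  rw [pgl2QClassCount, himage, Set.ncard_coe_finset,
    Finset.card_image_eq_sum_one_div_card_fiber hfin.toFinset πbar]
  refine Finset.sum_congr rfl fun O hO ↦ ?_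
  rw [Finset.filter_congr fun O' hO' ↦ hfiber O hO O' hO']

end BinaryQuartic

end Literature.NumberTheory.EllipticCurves

end
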